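import Mathlib
import HarnessLib
import Literature.MathematicalPhysics.QuantumLattice.HubbardSectorFieldSubstitution
import Literature.MathematicalPhysics.QuantumLattice.HubbardSectorPropagatorGram
import Summits.HubbardSuperconductivity.HubbardSuperconductivity.Theorems.KLProgrammeKLRegimeFatOverlapCount
import Summits.HubbardSuperconductivity.HubbardSuperconductivity.Theorems.KLProgrammeKLRegimeSliceSymbolTorus

/-!
# Route `KLProgramme` — crux K3 ENGINE (stmt-HubbardSuperconductivity-20437 `KLRegimeEngineV17F2`), stub (b) v2, THE LEVELS PACKAGE (ℓ):
# (I) item 1 of the «(ℓ)-LEV-ODD» cure — the TALKING RELATION of the sectorised block covariance and its count `c = 9`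
# (cell gate-hubbard-kl, seat hubbard-kl-k3c2-p3 g13; E1 may rename / supersede)

The oriented door `…EngineTowerBlockStepWtOriented.blockStep_ordersGe2_wtOriented_le` asks a relation `ov` on the coarse sector legs with
`(S(F̃)ᵀ Γ S(F̃)) X Y ≠ 0 → ov X.2 Y.2 ∧ ov Y.2 X.2` and `#{σ | ov σ σ′} ≤ c`.  Here, for ANY normal covariance `Γ = normalCovariance p` (momentum- and
spin-diagonal, pairing a field with a barred field — the CT slice covariance `C^K_{(Λ,Λ′]}` is of this form, `hubbardCovSliceCT_eq_normalCovariance_sliceSymbolFnXi`)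
and any multiplier family `F̃`, a nonzero entry of `S(F̃)ᵀ Γ S(F̃)` forces: the two sector multipliers share a momentum, the spins agree, the bar indices differ
(`talking_of_sectorSub_transpose_normalCovariance_sectorSub_ne_zero`); and for the fat family `F̃_k` (`k ≥ 1`) at most `9` legs talk to a given one
(`card_talking_bgmFat_le_nine`, from `card_overlap_bgmFat_le_nine'`).  So the door's line constant is `9·α`.
Compositions of landed facts; nothing asserts (ℓ), any stub, K3 or superconductivity.
References: BGM 2006 §2.7 (2.66), (2.71a), App. A4 (A4.8) [cite: BenfattoGiulianiMastropietro2006].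
-/

noncomputable section

namespace Summit.HubbardSuperconductivity.HubbardSuperconductivity.Theorems.EngineV8

set_option linter.dupNamespace false -- summit = problem name (single-conjunct summit), D-0017

open Finset Literature.MathematicalPhysics.QuantumLattice Literature.MathematicalPhysics.QuantumLattice.FermiRG
open Summit.HubbardSuperconductivity.HubbardSuperconductivity.Theorems.TorusFourierL2
open Summit.HubbardSuperconductivity.HubbardSuperconductivity.Theorems.KLProgrammeLegKernels

variable {L M : ℕ} [NeZero L] {N : ℕ}

/-- **A nonzero entry of the sectorised normal covariance makes the two legs TALK**: for `Γ = normalCovariance p` and any multiplier family `F̃`,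
`(S(F̃)ᵀ Γ S(F̃)) X Y ≠ 0` forces a common momentum of `F̃_{ω_X}` and `F̃_{ω_Y}`, equal spins and opposite bar indices. -/
theorem talking_of_sectorSub_transpose_normalCovariance_sectorSub_ne_zero (β : ℝ) (p : FreqMomentum L M × Fin 2 → ℂ)
    (Ft : Fin N → FreqMomentum L M → ℂ) (X Y : SpaceTimeIdx L M × SectorLeg N)
    (h : ((sectorSubMatrix L M β Ft).transpose * normalCovariance L M p * sectorSubMatrix L M β Ft) X Y ≠ 0) :
    (∃ q : FreqMomentum L M, Ft X.2.1.1 q * Ft Y.2.1.1 q ≠ 0) ∧ X.2.1.2 = Y.2.1.2 ∧ X.2.2 ≠ Y.2.2 := by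
  classical
  rw [Matrix.mul_apply] at h
  obtain ⟨K', -, hK'⟩ := exists_ne_zero_of_sum_ne_zero h
  have hS' : sectorSubMatrix L M β Ft K' Y ≠ 0 := right_ne_zero_of_mul hK'
  have hSC : ((sectorSubMatrix L M β Ft).transpose * normalCovariance L M p) X K' ≠ 0 := left_ne_zero_of_mul hK'
  rw [Matrix.mul_apply] at hSC
  obtain ⟨K, -, hK⟩ := exists_ne_zero_of_sum_ne_zero hSC
  have hS : sectorSubMatrix L M β Ft K X ≠ 0 := by
    have := left_ne_zero_of_mul hK
    rwa [Matrix.transpose_apply] at this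
  have hC : normalCovariance L M p K K' ≠ 0 := right_ne_zero_of_mul hK
  -- the substitution matrix: indices and the multiplier
  have hSX : (K.1.2 = X.2.1.2 ∧ K.2 = X.2.2) ∧ Ft X.2.1.1 K.1.1 ≠ 0 := by
    rw [sectorSubMatrix, Matrix.of_apply] at hS
    by_cases hc : K.1.2 = X.2.1.2 ∧ K.2 = X.2.2
    · rw [if_pos hc] at hS
      exact ⟨hc, left_ne_zero_of_mul (right_ne_zero_of_mul hS)⟩
    · rw [if_neg hc] at hS
      exact absurd rfl hS
  have hSY : (K'.1.2 = Y.2.1.2 ∧ K'.2 = Y.2.2) ∧ Ft Y.2.1.1 K'.1.1 ≠ 0 := by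
    rw [sectorSubMatrix, Matrix.of_apply] at hS'
    by_cases hc : K'.1.2 = Y.2.1.2 ∧ K'.2 = Y.2.2
    · rw [if_pos hc] at hS'
      exact ⟨hc, left_ne_zero_of_mul (right_ne_zero_of_mul hS')⟩
    · rw [if_neg hc] at hS'
      exact absurd rfl hS'
  -- the normal covariance: same (momentum, spin), opposite bar indices
  have hCK : K.1 = K'.1 ∧ K.2 ≠ K'.2 := by
    rw [normalCovariance_apply] at hC
    by_cases h1 : K.1 = K'.1
    · rw [if_pos h1] at hC
      refine ⟨h1, ?_⟩
      by_cases h01 : K.2 = 0 ∧ K'.2 = 1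
      · rw [h01.1, h01.2]; decide
      · rw [if_neg h01] at hC
        by_cases h10 : K.2 = 1 ∧ K'.2 = 0
        · rw [h10.1, h10.2]; decide
        · rw [if_neg h10] at hC
          exact absurd rfl hC
    · rw [if_neg h1] at hC
      exact absurd rfl hC
  obtain ⟨hK1, hK2⟩ := hCK
  have hq : K.1.1 = K'.1.1 := congrArg Prod.fst hK1
  have hs : K.1.2 = K'.1.2 := congrArg Prod.snd hK1
  refine ⟨⟨K.1.1, mul_ne_zero hSX.2 (by rw [hq]; exact hSY.2)⟩, ?_, ?_⟩
  · rw [← hSX.1.1, hs, hSY.1.1]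
  · rw [← hSX.1.2, ← hSY.1.2]
    exact hK2

/-- **The CT slice covariance makes the legs talk in the same way** (`Γ = C^K_{(Λ,Λ′]}`, `β ≠ 0`). -/
theorem talking_of_sectorSub_transpose_covSliceCT_sectorSub_ne_zero {β : ℝ} (hβ : β ≠ 0) (μ : ℝ) (Kp : TrigPolyC4v) (Λ Λ' : ℝ)
    (Ft : Fin N → FreqMomentum L M → ℂ) (X Y : SpaceTimeIdx L M × SectorLeg N)
    (h : ((sectorSubMatrix L M β Ft).transpose * hubbardCovSliceCT L M β μ 0 Kp Λ Λ' * sectorSubMatrix L M β Ft) X Y ≠ 0) :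
    (∃ q : FreqMomentum L M, Ft X.2.1.1 q * Ft Y.2.1.1 q ≠ 0) ∧ X.2.1.2 = Y.2.1.2 ∧ X.2.2 ≠ Y.2.2 := by
  rw [hubbardCovSliceCT_eq_normalCovariance_sliceSymbolFnXi hβ μ Kp Λ Λ'] at h
  exact talking_of_sectorSub_transpose_normalCovariance_sectorSub_ne_zero β _ Ft X Y h

omit [NeZero L] in
/-- The talking relation is symmetric. -/
theorem talking_symm (Ft : Fin N → FreqMomentum L M → ℂ) {σ σ' : SectorLeg N}
    (h : (∃ q : FreqMomentum L M, Ft σ.1.1 q * Ft σ'.1.1 q ≠ 0) ∧ σ.1.2 = σ'.1.2 ∧ σ.2 ≠ σ'.2) :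
    (∃ q : FreqMomentum L M, Ft σ'.1.1 q * Ft σ.1.1 q ≠ 0) ∧ σ'.1.2 = σ.1.2 ∧ σ'.2 ≠ σ.2 := by
  obtain ⟨⟨q, hq⟩, hs, hb⟩ := h
  exact ⟨⟨q, by rwa [mul_comm] at hq⟩, hs.symm, fun h' => hb h'.symm⟩

/-- **At most `9` legs talk to a given leg of the fat family** (`k ≥ 1`): the sector indices whose fat multipliers share a momentum with a given one
number `≤ 9` (`card_overlap_bgmFat_le_nine'`), the spin is determined, and so is the bar index (the other one). -/
theorem card_talking_bgmFat_le_nine {e₀ β μ : ℝ} {Kp : TrigPolyC4v} {k : ℕ} (hk : 1 ≤ k) (σ' : SectorLeg (sectorCount k)) :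
    ((univ : Finset (SectorLeg (sectorCount k))).filter fun σ : SectorLeg (sectorCount k) =>
      (∃ q : FreqMomentum L M, bgmFatMultiplier L M e₀ β (nambuXiCT L μ Kp) k σ.1.1 q * bgmFatMultiplier L M e₀ β (nambuXiCT L μ Kp) k σ'.1.1 q ≠ 0) ∧
        σ.1.2 = σ'.1.2 ∧ σ.2 ≠ σ'.2).card ≤ 9 := by
  classical
  obtain ⟨m, rfl⟩ : ∃ m, k = m + 1 := ⟨k - 1, (Nat.sub_add_cancel hk).symm⟩
  refine le_trans (card_le_card_of_injOn (fun σ : SectorLeg (sectorCount (m + 1)) => σ.1.1) (fun σ hσ => ?_) ?_)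
    (card_overlap_bgmFat_le_nine' (L := L) (M := M) (K := Kp) (μ := μ) (e₀ := e₀) (β := β) m σ'.1.1)
  · rw [mem_coe, mem_filter] at hσ ⊢
    exact ⟨mem_univ _, hσ.2.1⟩
  · intro σ₁ h₁ σ₂ h₂ h12
    rw [mem_coe, mem_filter] at h₁ h₂
    have hb : σ₁.2 = σ₂.2 := by
      have h1 := h₁.2.2.2
      have h2 := h₂.2.2.2
      revert h1 h2
      generalize σ₁.2 = a; generalize σ₂.2 = b; generalize σ'.2 = c
      intro h1 h2
      fin_cases a <;> fin_cases b <;> fin_cases c <;> simp_all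
    exact Prod.ext (Prod.ext h12 (h₁.2.2.1.trans h₂.2.2.1.symm)) hb

end Summit.HubbardSuperconductivity.HubbardSuperconductivity.Theorems.EngineV8
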